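import Literature.Analysis.Calculus.LocalInverseOnCompact
import Mathlib.Analysis.Analytic.OfScalars
import Mathlib.Analysis.Calculus.SmoothSeries
import Mathlib.Analysis.Calculus.Deriv.MeanValue
import Mathlib.Analysis.Calculus.Deriv.Pow
import HarnessLib

/-!
# PreShockDoor [S] kit · Part G — calculus of the local equation of state `G(z) = ∑ⱼ cⱼ z^{j+1}`

Generic real power series `gSer c z = ∑' j, c j * z ^ (j + 1)` with `c 0 = 1` and
`|c j| ≤ A q ^ j`: summability and the tail bound `|G z - z| ≤ 2 A q r²` on `|z| ≤ r`
(`q r ≤ 1/2`), termwise derivative `G' = ∑ (j+1) cⱼ zʲ ≥ 1/2` on `(-r, r)` (`8 A q r ≤ 1`,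
`q r ≤ 1/4`), strict monotonicity, smoothness (the series is the sum of the formal power series
`ofScalars ℝ (gcoef c)` of radius `≥ 2r`), and a `C^∞` inverse on `[G a, G b]` for
`[a, b] ⊂ (-r, r)` (globalised inverse function theorem along a compact set,
`Literature.Analysis.Calculus.exists_openPartialHomeomorph_contDiffOn_symm`).
decomp-a2c lens-1 g41; 0 sorry.
-/

noncomputable section

namespace Summit.AtomisticToContinuum.HydrodynamicLimit.Theorems.PreShockDoor

open Set Filter Topology
open scoped NNReal ENNReal ContDiff

/-! ## The series and its coefficients -/

/-- `G(z) = ∑ⱼ cⱼ z^{j+1}`. -/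
def gSer (c : ℕ → ℝ) (z : ℝ) : ℝ := ∑' j, c j * z ^ (j + 1)

/-- The termwise derivative `G'(z) = ∑ⱼ (j+1) cⱼ zʲ`. -/
def gDer (c : ℕ → ℝ) (z : ℝ) : ℝ := ∑' j : ℕ, ((j : ℝ) + 1) * c j * z ^ j

/-- The shifted coefficient sequence `(0, c₀, c₁, …)`. -/
def gcoef (c : ℕ → ℝ) (n : ℕ) : ℝ := if n = 0 then 0 else c (n - 1)

/-- `gcoef c 0 = 0`. [folklore] -/
theorem gcoef_zero (c : ℕ → ℝ) : gcoef c 0 = 0 := by simp [gcoef]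

/-- `gcoef c (j+1) = c j`. [folklore] -/
theorem gcoef_succ (c : ℕ → ℝ) (j : ℕ) : gcoef c (j + 1) = c j := by simp [gcoef]

section Bounds

variable {c : ℕ → ℝ} {A q r : ℝ}

/-- Termwise bound `|cⱼ z^{j+1}| ≤ A r (q r)ʲ` for `|z| ≤ r`. -/
theorem abs_term_le (hc : ∀ j, |c j| ≤ A * q ^ j) (hq : 0 ≤ q) (_hr : 0 ≤ r) {z : ℝ}
    (hz : |z| ≤ r) (j : ℕ) : |c j * z ^ (j + 1)| ≤ A * r * (q * r) ^ j := by
  have hA : 0 ≤ A := le_trans (abs_nonneg _) ((hc 0).trans_eq (by simp))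
  rw [abs_mul, abs_pow]
  calc |c j| * |z| ^ (j + 1) ≤ (A * q ^ j) * r ^ (j + 1) := by
        gcongr
        exact hc j
    _ = A * r * (q * r) ^ j := by rw [mul_pow]; ring

/-- The series is summable for `|z| ≤ r`, `q r < 1`. -/
theorem summable_term (hc : ∀ j, |c j| ≤ A * q ^ j) (hq : 0 ≤ q) (hr : 0 ≤ r) (hqr : q * r < 1)
    {z : ℝ} (hz : |z| ≤ r) : Summable fun j => c j * z ^ (j + 1) :=
  Summable.of_norm_bounded
    ((summable_geometric_of_lt_one (mul_nonneg hq hr) hqr).mul_left (A * r))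
    fun j => (Real.norm_eq_abs _).trans_le (abs_term_le hc hq hr hz j)

/-- **Tail bound** `|G z - z| ≤ 2 A q r²` for `|z| ≤ r`, `q r ≤ 1/2` (`c₀ = 1`). -/
theorem abs_gSer_sub_le (hc0 : c 0 = 1) (hc : ∀ j, |c j| ≤ A * q ^ j) (hq : 0 ≤ q) (hr : 0 ≤ r)
    (hqr : q * r ≤ 1 / 2) {z : ℝ} (hz : |z| ≤ r) : |gSer c z - z| ≤ 2 * A * q * r ^ 2 := by
  have hA : 0 ≤ A := le_trans (abs_nonneg _) ((hc 0).trans_eq (by simp))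
  have hqr1 : q * r < 1 := by linarith
  have hs := summable_term hc hq hr hqr1 hz
  rw [gSer, hs.tsum_eq_zero_add, hc0, one_mul, zero_add, pow_one, add_sub_cancel_left]
  have hgeo : HasSum (fun j : ℕ => A * r * (q * r) ^ (j + 1)) (A * r * (q * r) / (1 - q * r)) := by
    have h := (hasSum_geometric_of_lt_one (mul_nonneg hq hr) hqr1).mul_left (A * r * (q * r))
    rw [div_eq_mul_inv]
    refine h.congr_fun fun j => ?_
    rw [pow_succ]; ring
  have htail : |∑' j, c (j + 1) * z ^ (j + 1 + 1)| ≤ A * r * (q * r) / (1 - q * r) := by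
    refine (Real.norm_eq_abs _).symm.trans_le (tsum_of_norm_bounded hgeo fun j => ?_)
    exact (Real.norm_eq_abs _).trans_le (abs_term_le hc hq hr hz (j + 1))
  refine htail.trans ?_
  rw [div_le_iff₀ (by linarith)]
  have h1 : 0 ≤ A * r * (q * r) := by positivity
  nlinarith

/-- `G 0 = 0`. -/
theorem gSer_zero (c : ℕ → ℝ) : gSer c 0 = 0 := by
  simp [gSer]

end Bounds

/-! ## Termwise differentiation -/

section Deriv

variable {c : ℕ → ℝ} {A q r : ℝ}

/-- `(j+1) xʲ ≤ (2x)ʲ`-type bound: `(j + 1) ≤ 2ʲ`. -/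
theorem succ_le_two_pow (j : ℕ) : ((j : ℝ) + 1) ≤ (2 : ℝ) ^ j := by
  have h : j + 1 ≤ 2 ^ j := Nat.lt_two_pow_self
  exact_mod_cast h

/-- **Termwise derivative**: on `(-r, r)` with `q r ≤ 1/4`, `G` has derivative `G'`. -/
theorem hasDerivAt_gSer (hc : ∀ j, |c j| ≤ A * q ^ j) (hq : 0 ≤ q) (hr : 0 < r)
    (hqr : q * r ≤ 1 / 4) {y : ℝ} (hy : y ∈ Ioo (-r) r) :
    HasDerivAt (gSer c) (gDer c y) y := by
  have hA : 0 ≤ A := le_trans (abs_nonneg _) ((hc 0).trans_eq (by simp))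
  have h2qr : 2 * (q * r) < 1 := by linarith
  -- summable bounds `u j = A (2 q r)ʲ`
  have hu : Summable fun j : ℕ => A * (2 * (q * r)) ^ j :=
    (summable_geometric_of_lt_one (by positivity) h2qr).mul_left A
  have hderiv : ∀ (j : ℕ), ∀ z ∈ Ioo (-r) r,
      HasDerivAt (fun z => c j * z ^ (j + 1)) (((j : ℝ) + 1) * c j * z ^ j) z := by
    intro j z _
    have h := (hasDerivAt_pow (j + 1) z).const_mul (c j)
    simp only [Nat.add_sub_cancel, Nat.cast_add, Nat.cast_one] at h
    exact h.congr_deriv (by ring)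
  have hbound : ∀ (j : ℕ), ∀ z ∈ Ioo (-r) r, ‖((j : ℝ) + 1) * c j * z ^ j‖ ≤ A * (2 * (q * r)) ^ j := by
    intro j z hz
    have hz' : |z| ≤ r := abs_le.2 ⟨hz.1.le, hz.2.le⟩
    rw [Real.norm_eq_abs, abs_mul, abs_mul, abs_pow, abs_of_nonneg (by positivity : (0:ℝ) ≤ (j:ℝ) + 1)]
    calc ((j : ℝ) + 1) * |c j| * |z| ^ j ≤ (2 : ℝ) ^ j * (A * q ^ j) * r ^ j := by
          gcongr
          · exact succ_le_two_pow j
          · exact hc j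
      _ = A * (2 * (q * r)) ^ j := by rw [mul_pow, mul_pow]; ring
  have h0 : (0 : ℝ) ∈ Ioo (-r) r := ⟨by linarith, hr⟩
  have hs0 : Summable fun j => c j * (0 : ℝ) ^ (j + 1) := by simp [summable_zero]
  have h := hasDerivAt_tsum_of_isPreconnected hu isOpen_Ioo isPreconnected_Ioo hderiv hbound h0 hs0 hy
  rw [show gSer c = fun z => ∑' (n : ℕ), c n * z ^ (n + 1) from rfl, gDer]
  exact h

/-- **Lower bound on the derivative**: `G'(y) ≥ 1 - 4 A q r` on `(-r, r)` (`c₀ = 1`, `q r ≤ 1/4`). -/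
theorem gDer_ge (hc0 : c 0 = 1) (hc : ∀ j, |c j| ≤ A * q ^ j) (hq : 0 ≤ q) (hr : 0 < r)
    (hqr : q * r ≤ 1 / 4) {y : ℝ} (hy : y ∈ Ioo (-r) r) : 1 - 4 * A * q * r ≤ gDer c y := by
  have hA : 0 ≤ A := le_trans (abs_nonneg _) ((hc 0).trans_eq (by simp))
  have h2qr : 2 * (q * r) < 1 := by linarith
  have hy' : |y| ≤ r := abs_le.2 ⟨hy.1.le, hy.2.le⟩
  have hterm : ∀ j : ℕ, |((j : ℝ) + 1) * c j * y ^ j| ≤ A * (2 * (q * r)) ^ j := by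
    intro j
    rw [abs_mul, abs_mul, abs_pow, abs_of_nonneg (by positivity : (0:ℝ) ≤ (j:ℝ) + 1)]
    calc ((j : ℝ) + 1) * |c j| * |y| ^ j ≤ (2 : ℝ) ^ j * (A * q ^ j) * r ^ j := by
          gcongr
          · exact succ_le_two_pow j
          · exact hc j
      _ = A * (2 * (q * r)) ^ j := by rw [mul_pow, mul_pow]; ring
  have hs : Summable fun j : ℕ => ((j : ℝ) + 1) * c j * y ^ j :=
    Summable.of_norm_bounded ((summable_geometric_of_lt_one (by positivity) h2qr).mul_left A)
      fun j => (Real.norm_eq_abs _).trans_le (hterm j)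
  rw [gDer, hs.tsum_eq_zero_add]
  simp only [Nat.cast_zero, zero_add, one_mul, hc0, pow_zero]
  have hgeo : HasSum (fun j : ℕ => A * (2 * (q * r)) ^ (j + 1)) (A * (2 * (q * r)) / (1 - 2 * (q * r))) := by
    have h := (hasSum_geometric_of_lt_one (by positivity) h2qr).mul_left (A * (2 * (q * r)))
    rw [div_eq_mul_inv]
    refine h.congr_fun fun j => ?_
    rw [pow_succ]; ring
  have htail : |∑' j : ℕ, (((j + 1 : ℕ) : ℝ) + 1) * c (j + 1) * y ^ (j + 1)| ≤
      A * (2 * (q * r)) / (1 - 2 * (q * r)) := by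
    refine (Real.norm_eq_abs _).symm.trans_le (tsum_of_norm_bounded hgeo fun j => ?_)
    exact (Real.norm_eq_abs _).trans_le (hterm (j + 1))
  have hle : A * (2 * (q * r)) / (1 - 2 * (q * r)) ≤ 4 * A * q * r := by
    rw [div_le_iff₀ (by linarith)]
    have : 0 ≤ A * (q * r) := by positivity
    nlinarith
  have := neg_abs_le (∑' j : ℕ, (((j + 1 : ℕ) : ℝ) + 1) * c (j + 1) * y ^ (j + 1))
  push_cast at this htail ⊢
  linarith

/-- `G` is continuous on `(-r, r)`. -/
theorem continuousOn_gSer (hc : ∀ j, |c j| ≤ A * q ^ j) (hq : 0 ≤ q) (hr : 0 < r)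
    (hqr : q * r ≤ 1 / 4) : ContinuousOn (gSer c) (Ioo (-r) r) := fun _ hy =>
  (hasDerivAt_gSer hc hq hr hqr hy).continuousAt.continuousWithinAt

/-- **`G` is strictly increasing on `(-r, r)`** when `8 A q r ≤ 1` (then `G' ≥ 1/2`). -/
theorem strictMonoOn_gSer (hc0 : c 0 = 1) (hc : ∀ j, |c j| ≤ A * q ^ j) (hq : 0 ≤ q) (hr : 0 < r)
    (hqr : q * r ≤ 1 / 4) (hAqr : 8 * A * q * r ≤ 1) : StrictMonoOn (gSer c) (Ioo (-r) r) := by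
  refine strictMonoOn_of_deriv_pos (convex_Ioo _ _) (continuousOn_gSer hc hq hr hqr) fun y hy => ?_
  rw [interior_Ioo] at hy
  rw [(hasDerivAt_gSer hc hq hr hqr hy).deriv]
  have := gDer_ge hc0 hc hq hr hqr hy
  linarith

end Deriv

/-! ## Smoothness: the series is the sum of a formal power series of radius `≥ 2r` -/

section Smooth

variable {c : ℕ → ℝ} {A q r : ℝ}

/-- Radius bound: if `q ρ ≤ 1` then `ρ ≤ radius (ofScalars ℝ (gcoef c))`. -/
theorem le_radius_gcoef (hc : ∀ j, |c j| ≤ A * q ^ j) (hq : 0 ≤ q) {ρ : ℝ≥0} (hqρ : q * ρ ≤ 1) :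
    (ρ : ℝ≥0∞) ≤ (FormalMultilinearSeries.ofScalars ℝ (gcoef c)).radius := by
  have hA : 0 ≤ A := le_trans (abs_nonneg _) ((hc 0).trans_eq (by simp))
  refine FormalMultilinearSeries.le_radius_of_bound _ (A * ρ) fun n => ?_
  rw [FormalMultilinearSeries.ofScalars_norm]
  cases n with
  | zero => simp [gcoef_zero]; positivity
  | succ j =>
    rw [gcoef_succ, Real.norm_eq_abs]
    calc |c j| * (ρ : ℝ) ^ (j + 1) ≤ (A * q ^ j) * (ρ : ℝ) ^ (j + 1) := by
          gcongr; exact hc j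
      _ = A * ρ * (q * ρ) ^ j := by rw [mul_pow]; ring
      _ ≤ A * ρ * 1 := by
          gcongr
          exact pow_le_one₀ (by positivity) hqρ
      _ = A * ρ := mul_one _

/-- On `|z| ≤ r` (`q r < 1`) the formal power series sums to `G`. -/
theorem ofScalarsSum_gcoef_eq (hc : ∀ j, |c j| ≤ A * q ^ j) (hq : 0 ≤ q) (hr : 0 ≤ r)
    (hqr : q * r < 1) {z : ℝ} (hz : |z| ≤ r) :
    FormalMultilinearSeries.ofScalarsSum (E := ℝ) (gcoef c) z = gSer c z := by
  rw [FormalMultilinearSeries.ofScalars_sum_eq]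
  simp only [smul_eq_mul]
  rw [tsum_eq_zero_add']
  · simp only [gcoef_zero, zero_mul, zero_add, gcoef_succ, gSer]
  · simp only [gcoef_succ]
    exact summable_term hc hq hr hqr hz

/-- **`G` is `C^∞` on `(-r, r)`** when `2 q r ≤ 1`. -/
theorem contDiffOn_gSer (hc : ∀ j, |c j| ≤ A * q ^ j) (hq : 0 ≤ q) (hr : 0 < r)
    (hqr : q * r ≤ 1 / 4) : ContDiffOn ℝ ∞ (gSer c) (Ioo (-r) r) := by
  intro y hy
  -- radius ≥ 2r
  set ρ : ℝ≥0 := ⟨2 * r, by positivity⟩ with hρ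
  have hqρ : q * (ρ : ℝ) ≤ 1 := by
    show q * (2 * r) ≤ 1
    linarith
  have hrad := le_radius_gcoef (c := c) hc hq hqρ
  have hpos : 0 < (FormalMultilinearSeries.ofScalars ℝ (gcoef c)).radius :=
    lt_of_lt_of_le (by exact_mod_cast (show (0 : ℝ≥0) < ρ from by
      rw [hρ]; exact_mod_cast (show (0:ℝ) < 2 * r by positivity))) hrad
  have hball := (FormalMultilinearSeries.ofScalars ℝ (gcoef c)).hasFPowerSeriesOnBall hpos
  have hyball : y ∈ Metric.eball (0 : ℝ) (FormalMultilinearSeries.ofScalars ℝ (gcoef c)).radius := by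
    refine Metric.mem_eball.2 (lt_of_lt_of_le ?_ hrad)
    rw [edist_lt_coe]
    rw [← NNReal.coe_lt_coe, coe_nndist, Real.dist_eq, sub_zero, hρ]
    show |y| < 2 * r
    have := abs_lt.2 ⟨hy.1, hy.2⟩
    linarith
  have han : AnalyticAt ℝ (FormalMultilinearSeries.ofScalarsSum (E := ℝ) (gcoef c)) y :=
    hball.analyticAt_of_mem hyball
  have hcd : ContDiffAt ℝ ∞ (FormalMultilinearSeries.ofScalarsSum (E := ℝ) (gcoef c)) y :=
    han.contDiffAt
  -- the two functions agree near `y`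
  have heq : FormalMultilinearSeries.ofScalarsSum (E := ℝ) (gcoef c) =ᶠ[𝓝 y] gSer c := by
    filter_upwards [isOpen_Ioo.mem_nhds hy] with z hz
    exact ofScalarsSum_gcoef_eq hc hq hr.le (by linarith) (abs_le.2 ⟨hz.1.le, hz.2.le⟩)
  exact (hcd.congr_of_eventuallyEq heq.symm).contDiffWithinAt

end Smooth

/-! ## The smooth inverse along a compact interval -/

section Inverse

variable {c : ℕ → ℝ} {A q r : ℝ}

/-- **Smooth inverse of `G` on `[G a, G b]`** for `[a, b] ⊂ (-r, r)`: there is `Ginv : ℝ → ℝ`,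
`C^∞` on `Icc (G a) (G b)`, with `Ginv (G z) = z` on a neighbourhood of `[a, b]` inside
`(-r, r)`, in particular on `[a, b]`. -/
theorem exists_smooth_inverse (hc0 : c 0 = 1) (hc : ∀ j, |c j| ≤ A * q ^ j) (hq : 0 ≤ q)
    (hr : 0 < r) (hqr : q * r ≤ 1 / 4) (hAqr : 8 * A * q * r ≤ 1) {a b : ℝ} (hab : a ≤ b)
    (ha : -r < a) (hb : b < r) :
    ∃ Ginv : ℝ → ℝ, ContDiffOn ℝ ∞ Ginv (Icc (gSer c a) (gSer c b)) ∧
      ∀ z ∈ Icc a b, Ginv (gSer c z) = z := by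
  have hU : IsOpen (Ioo (-r) r) := isOpen_Ioo
  have hKU : Icc a b ⊆ Ioo (-r) r := fun z hz => ⟨lt_of_lt_of_le ha hz.1, lt_of_le_of_lt hz.2 hb⟩
  have hcd := contDiffOn_gSer hc hq hr hqr
  have hmono := strictMonoOn_gSer hc0 hc hq hr hqr hAqr
  have hder : ∀ x ∈ Ioo (-r) r, ∃ f' : ℝ ≃L[ℝ] ℝ, HasFDerivAt (gSer c) (f' : ℝ →L[ℝ] ℝ) x := by
    intro x hx
    have hd := hasDerivAt_gSer hc hq hr hqr hx
    have hpos : gDer c x ≠ 0 := by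
      have := gDer_ge hc0 hc hq hr hqr hx
      have hA : 0 ≤ A := le_trans (abs_nonneg _) ((hc 0).trans_eq (by simp))
      intro h0; rw [h0] at this; nlinarith
    exact ⟨_, hd.hasFDerivAt_equiv hpos⟩
  obtain ⟨e, hecoe, hKe, heU, hsymm⟩ :=
    Literature.Analysis.Calculus.exists_openPartialHomeomorph_contDiffOn_symm (𝕂 := ℝ)
      (n := (∞ : WithTop ℕ∞)) (by simp) hU hKU isCompact_Icc hcd hder
      ((hmono.injOn).mono hKU)
  refine ⟨e.symm, hsymm.mono ?_, fun z hz => ?_⟩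
  · -- `[G a, G b] ⊆ G '' [a, b] ⊆ e.target`
    intro w hw
    have hcont : ContinuousOn (gSer c) (Icc a b) := hcd.continuousOn.mono hKU
    obtain ⟨z, hz, rfl⟩ := intermediate_value_Icc hab hcont hw
    rw [← hecoe]
    exact e.map_source (hKe hz)
  · have := e.left_inv (hKe hz)
    rwa [hecoe] at this

end Inverse

end Summit.AtomisticToContinuum.HydrodynamicLimit.Theorems.PreShockDoor
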